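import Summits.BirchSwinnertonDyer.Rank1Residual.ManinAdditive.NeronConway
import Summits.BirchSwinnertonDyer.Rank1Residual.ManinAdditive.NeronConwayR
import Literature.NumberTheory.EllipticCurves.ModularCurveSturmProofs
import HarnessLib

/-!
# THE R₄-DEFECT SPACE `D(N) = S^G / K(N)` OF THE CONWAY LATTICE: exponent law E-imc-134 and tower-count law E-imc-135
# (cell `bsd-f2-manin`; conjecture leaf typed by the typer g13 from planner imc g18's Sketch-imc-g18c 1795513e2c11c474 VERBATIM,
# T-imc-20, with refuter REF1 §R73 (HOME/ref1/R73-ref1-imc-g18.md c1f452de4a35d15e; kernel block ref1-C80-imc-g18-audit.lean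
# e1aa1b9132f32869) folded)

TYPER FRAMING.  imc's sketch VERBATIM (defs `cuspDim`, `cuspDimDiv`, `towerCountFlat`, `ramanujanFourPreimage`; the two laws
tagged `@[conjecture]`: E-imc-134 `ConwayRamanujanExponentLaw`, E-imc-135 `ConwayRamanujanDefectCountLaw`; PROVED
`ramanujanFourPreimage_le`, `two_smul_mem_ramanujanFourPreimage`).  REF1 §R73: «E-134/135 SOUND (finrank honest; value = fact
`finrank_cuspForm_two_eq_genusX0`; relIndex = [S^G : K(N)]; scope honest)»; BC7 7/7 clean.  REF1's kernel lemmas A80.1–A80.8 are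
landed below with attribution (namespace `…NeronConwayD`, REF1's `RefAudit80` label dropped): A80.1 the `R₄`/`R₈` weight-2
scalars are `1` and the translation matrices have determinant `16`/`64`; A80.2 E-imc-127's `U₂` is the bare double coset;
A80.3 `S^{G,R}` (tree `NeronConwayR.endSaturatedConwayLattice`) IS a maximum — stable under `w_{Q_p}`, `t`, `R₄` (`16 ∣ N`),
`R₈` (`64 ∣ N`) — and every stable integral lattice lies in it; A80.4 the orientation of E-imc-135's `relIndex`; A80.5 `cuspDim`
soundness and the `16 ∥ N` collapse `♭(N) = s(N/16)`; A80.6/A80.7 E-imc-134 ⟹ `2·S^G ≤ K(N)` and `LeUpToOdd`-stability under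
`2R₄`; A80.8 E-imc-132 ⟹ `Λ ≤ S^G`.  REF1 N5 (scope note for E-imc-127 in `NeronConway.lean`, recorded here until that file is
next touched): E-imc-127 is «a corollary of THEOREM N=C» only on the (b)-cells `v₂(N) = 2` / `v₂(N) = 3 ∧ ∃ p′ ≡ 3 (4)`; on
`N ∈ {40, 104, 136, 200, 232, 296, 328, 424, 488, 520, …}` (ENGINE 6 defect 0) it is a LAW.  bears_on: stmt-BirchSwinnertonDyer-22967.
Nothing asserted beyond PROVED theorems.  BSD is not proved by this; Manin's conjecture is not proved by this.

# Sketch-imc-g18c — the R₄-DEFECT SPACE `D(N)` of the Conway lattice: exponent law and tower-count law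
(imc g18, MEMO-imc §24.10 / §24.14 / §24.15; ENGINE 6 v5b–v9, kit j311843 j311881 j312050 j312225 j312289)

For `16 ∣ N` put `R₄ = ramanujanFour N 2` (`= t_{1/4} + t_{3/4}`; `w R₄ w⁻¹ = Tr^N_{N/4} − Tr^N_{N/2}`, MEMO §24.14) and
`K(N) := {x ∈ S^G : R₄ x ∈ S^G}`.  DATA (E-blind, pre-registered where marked):
* EXPONENT: `2 • R₄ (S^G) ⊆ S^G` at all 40 levels computed (16 ∣ N ≤ 640; 704, 768, 896, 960) — `D(N) := S^G / K(N)` is an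
  `𝔽₂`-space; equivalently the congruence module `C(S^G; S₂(N/4))₂` has exponent `≤ 8` and `dim D(N) = #{ℤ/8 factors}`.
* COUNT (law E-imc-130♭, PRE-REGISTERED, 55/55 levels ≤ 1088 incl. the length-6 discriminator 896 → 4):
  `dim_{𝔽₂} D(N) = [s(N/16) − s(N/32)] + [s(N/64) − s(N/128)]`, `s(M) = dim S₂(Γ₀(M))` (a term read as 0 when `M ∉ ℕ`)
  = #{2-towers of length ≥ 4} + #{length ≥ 6}.  For `256 ∣ N` a tower of length ≥ 8 can occur and the natural
  extension `Σ_towers ⌊(e−2)/2⌋₊` (E-imc-130♮) is untested (N = 2816 job j312133) — hence the scope `¬ 256 ∣ N` below.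
Nothing here is asserted; both `Prop`s are conjecture-candidates for -ref1 audit and -ty typing (ask T-imc-20).
-/
open scoped MatrixGroups ModularForm
open CongruenceSubgroup Literature.NumberTheory.EllipticCurves.ModularForms
open Summit.BirchSwinnertonDyer.Rank1Residual.ManinAdditive
open Summit.BirchSwinnertonDyer.Rank1Residual.ManinAdditive.ConwayCut
open Summit.BirchSwinnertonDyer.Rank1Residual.ManinAdditive.NeronConway

noncomputable section

namespace Summit.BirchSwinnertonDyer.Rank1Residual.ManinAdditive.NeronConwayD

/-- `s(M) = dim_ℂ S₂(Γ₀(M))`. -/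
def cuspDim (M : ℕ) : ℕ := Module.finrank ℂ (CuspForm (Gamma0 M) 2)

/-- `s(N/d)` read as `0` when `d ∤ N`. -/
def cuspDimDiv (N d : ℕ) : ℕ := if d ∣ N then cuspDim (N / d) else 0

/-- `♭(N) := [s(N/16) − s(N/32)] + [s(N/64) − s(N/128)]` = #{2-towers of length ≥ 4} + #{2-towers of length ≥ 6}
(a 2-tower = the old classes `h(q^{d·2^j})`, `0 ≤ j ≤ e`, of a newform `h` of level `M ∣ N` and an odd `d ∣ N/M`, `e = v₂(N/(dM))`). -/
def towerCountFlat (N : ℕ) : ℕ := (cuspDimDiv N 16 - cuspDimDiv N 32) + (cuspDimDiv N 64 - cuspDimDiv N 128)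

variable (N : ℕ) [NeZero N]

/-- `K(N) = {x ∈ S^G : R₄ x ∈ S^G}`, the `R₄`-preimage of the Conway lattice inside itself. -/
def ramanujanFourPreimage : Submodule ℤ (CuspForm (Gamma0 N) 2) :=
  conwayStableLattice N ⊓ (conwayStableLattice N).comap ((ramanujanFour N 2).restrictScalars ℤ)

/-- `K(N) ≤ S^G`. -/
theorem ramanujanFourPreimage_le : ramanujanFourPreimage N ≤ conwayStableLattice N := inf_le_left

/-- E-imc-134 `ConwayRamanujanExponentLaw` (EXPONENT 8): `2·R₄(S^G) ⊆ S^G` whenever `16 ∣ N`; equivalently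
`2 • S^G ≤ K(N)`, i.e. `D(N) = S^G/K(N)` is killed by 2.  40/40 levels.  Why it might fail: a level with three or more
mutually congruent long towers could force a `ℤ/16` in `C(S^G; S₂(N/4))` (none ≤ 960; `C(S^G; S₂(N/8))` DOES contain `ℤ/16`). -/
@[conjecture]
def ConwayRamanujanExponentLaw : Prop :=
  ∀ (N : ℕ) [NeZero N], 16 ∣ N →
    ∀ x ∈ conwayStableLattice N, (2 : ℤ) • ramanujanFour N 2 x ∈ conwayStableLattice N

/-- E-imc-135 `ConwayRamanujanDefectCountLaw` (law E-imc-130♭ as an index statement): for `16 ∣ N`, `256 ∤ N`,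
`[S^G : K(N)] = 2^{♭(N)}`.  PRE-REGISTERED by code (E130flat-predictions-16N-2000.txt a63338fff66c7a42); 55/55 levels
≤ 1088 (all with `256 ∤ N` or no tower of length ≥ 8).  Why it might fail: the count was FITTED on ≤ 912 after two
pre-registered predecessors died (E-130 at 528, ♯ at 704); a level with ≥ 3 long towers of one newform (e.g. `N = 2^4·M`,
`M` with many odd divisors) is the stress case (mass test ≤ 2000 running, jobs j312050 j312398 j312405). -/
@[conjecture]
def ConwayRamanujanDefectCountLaw : Prop :=
  ∀ (N : ℕ) [NeZero N], 16 ∣ N → ¬ 256 ∣ N →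
    (ramanujanFourPreimage N).toAddSubgroup.relIndex (conwayStableLattice N).toAddSubgroup = 2 ^ towerCountFlat N

/-- Under the exponent law the defect space is an honest `𝔽₂`-space: `2 • x ∈ K(N)` for every `x ∈ S^G`. -/
theorem two_smul_mem_ramanujanFourPreimage (h : ConwayRamanujanExponentLaw) (h16 : 16 ∣ N)
    {x : CuspForm (Gamma0 N) 2} (hx : x ∈ conwayStableLattice N) :
    (2 : ℤ) • x ∈ ramanujanFourPreimage N := by
  refine ⟨Submodule.smul_mem _ _ hx, ?_⟩
  show ((ramanujanFour N 2).restrictScalars ℤ) ((2 : ℤ) • x) ∈ conwayStableLattice N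
  rw [LinearMap.restrictScalars_apply, map_zsmul]
  exact h N h16 x hx

/-! ### REF1 §R73 kernel lemmas A80.1–A80.8 (refuter-ref1 g10, HOME/ref1/ref1-C80-imc-g18-audit.lean; landed with attribution) -/

section RefAudit80

open NeronConwayR

/-- A80.1a  `R₄` carries NO scalar at weight 2: `16^{1 − 2/2} = 1` (so E-imc-129/134/135 are statements about the bare
sum of the two coset operators `f ↦ f(z+¼) + f(z+¾)`, `aₙ ↦ (iⁿ + (−i)ⁿ) aₙ ∈ {0, ±2}·aₙ`; Mathlib slash at `k = 2`:
`det^{k−1}(cz+d)^{−k} = 16 · 4^{−2} = 1`). -/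
theorem ramanujanFour_weight_two_scalar : ((16 : ℝ) ^ (1 - ((2 : ℤ) : ℝ) / 2)) = 1 := by norm_num

/-- A80.1a  `R₄` at weight 2 is the bare sum of the two quarter-translation coset operators. -/
theorem ramanujanFour_two_eq (N : ℕ) [NeZero N] :
    ramanujanFour N 2 =
      cuspHeckeOperatorₗ (Gamma0 N) 2 (quarterTranslateGL 1) + cuspHeckeOperatorₗ (Gamma0 N) 2 (quarterTranslateGL 3) := by
  rw [show ramanujanFour N 2 = (((16 : ℝ) ^ (1 - ((2 : ℤ) : ℝ) / 2) : ℝ) : ℂ) •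
      (cuspHeckeOperatorₗ (Gamma0 N) 2 (quarterTranslateGL 1) + cuspHeckeOperatorₗ (Gamma0 N) 2 (quarterTranslateGL 3))
      from rfl, ramanujanFour_weight_two_scalar]
  simp

/-- A80.1b  Same for `R₈`: `64^{1 − 2/2} = 1`. -/
theorem ramanujanEight_weight_two_scalar : ((64 : ℝ) ^ (1 - ((2 : ℤ) : ℝ) / 2)) = 1 := by norm_num

/-- A80.1b  `R₈` at weight 2 is the bare sum of the four eighth-translation coset operators. -/
theorem ramanujanEight_two_eq (N : ℕ) [NeZero N] :
    ramanujanEight N 2 =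
      cuspHeckeOperatorₗ (Gamma0 N) 2 (eighthTranslateGL 1) + cuspHeckeOperatorₗ (Gamma0 N) 2 (eighthTranslateGL 3) +
        cuspHeckeOperatorₗ (Gamma0 N) 2 (eighthTranslateGL 5) + cuspHeckeOperatorₗ (Gamma0 N) 2 (eighthTranslateGL 7) := by
  rw [show ramanujanEight N 2 = (((64 : ℝ) ^ (1 - ((2 : ℤ) : ℝ) / 2) : ℝ) : ℂ) •
      (cuspHeckeOperatorₗ (Gamma0 N) 2 (eighthTranslateGL 1) + cuspHeckeOperatorₗ (Gamma0 N) 2 (eighthTranslateGL 3) +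
        cuspHeckeOperatorₗ (Gamma0 N) 2 (eighthTranslateGL 5) + cuspHeckeOperatorₗ (Gamma0 N) 2 (eighthTranslateGL 7))
      from rfl, ramanujanEight_weight_two_scalar]
  simp

/-- A80.1c  The matrices: `det (4 j; 0 4) = 16`, `det (8 j; 0 8) = 64` (single cosets in the normaliser of `Γ₀(N)` iff
`16 ∣ N` resp. `64 ∣ N`: conjugating `(a b; c d) ∈ Γ₀(N)` by `z ↦ z + j/h` needs `h ∣ c`, `h² ∣ c` and `h ∣ d − a`, the
last being automatic from `ad ≡ 1 (mod h²)`, `a² ≡ 1 (mod 8)` exactly for `h ∣ 8` — Atkin–Lehner's `h ∣ 24`). -/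
theorem quarterTranslateGL_det (j : ℕ) :
    (((quarterTranslateGL j : GL (Fin 2) ℚ) : Matrix (Fin 2) (Fin 2) ℚ)).det = 16 := by
  simp [quarterTranslateGL, Matrix.det_fin_two]; norm_num

/-- A80.1c (`R₈` matrices). -/
theorem eighthTranslateGL_det (j : ℕ) :
    (((eighthTranslateGL j : GL (Fin 2) ℚ) : Matrix (Fin 2) (Fin 2) ℚ)).det = 64 := by
  simp [eighthTranslateGL, Matrix.det_fin_two]; norm_num

/-- A80.2  E-imc-127's `U₂` is the BARE double coset `[Γ₀(N) diag(1,2) Γ₀(N)]` at weight 2 (arithmetic normalisation,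
`aₙ ↦ a_{2n}` when `2 ∣ N`): definitional. -/
theorem heckeT_two_two_def (N : ℕ) [NeZero N] :
    heckeT (Gamma0 N) 2 2 = cuspHeckeOperatorₗ (Gamma0 N) 2 (diagGL 1 2 one_pos (Nat.cast_pos.mpr (NeZero.pos 2))) :=
  rfl

/-- A80.3  `S^{G,R}` is a MAXIMUM: the `sSup` is itself `R₄`-stable at `16 ∣ N` … -/
theorem endSaturatedConwayLattice_map_ramanujanFour_le {N : ℕ} [NeZero N] (h16 : 16 ∣ N) :
    (endSaturatedConwayLattice N).map ((ramanujanFour N 2).restrictScalars ℤ) ≤ endSaturatedConwayLattice N := by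
  rw [Submodule.map_le_iff_le_comap]
  exact sSup_le fun M hM => Submodule.map_le_iff_le_comap.mp ((hM.2.2.2.1 h16).trans (le_sSup hM))

/-- … `R₈`-stable at `64 ∣ N` … -/
theorem endSaturatedConwayLattice_map_ramanujanEight_le {N : ℕ} [NeZero N] (h64 : 64 ∣ N) :
    (endSaturatedConwayLattice N).map ((ramanujanEight N 2).restrictScalars ℤ) ≤ endSaturatedConwayLattice N := by
  rw [Submodule.map_le_iff_le_comap]
  exact sSup_le fun M hM => Submodule.map_le_iff_le_comap.mp ((hM.2.2.2.2 h64).trans (le_sSup hM))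

/-- … `t`-stable … -/
theorem endSaturatedConwayLattice_map_halfTranslate_le {N : ℕ} [NeZero N] :
    (endSaturatedConwayLattice N).map ((halfTranslate N 2).restrictScalars ℤ) ≤ endSaturatedConwayLattice N := by
  rw [Submodule.map_le_iff_le_comap]
  exact sSup_le fun M hM => Submodule.map_le_iff_le_comap.mp (hM.2.2.1.trans (le_sSup hM))

/-- … and `w_{Q_p}`-stable; together with `endSaturatedConwayLattice_le` this makes «largest such sublattice» literal. -/
theorem endSaturatedConwayLattice_map_atkinLehner_le {N : ℕ} [NeZero N] (p : ℕ) (hp : p.Prime) (hpN : p ∣ N) :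
    (endSaturatedConwayLattice N).map ((atkinLehnerInvolutionAt N 2 p).restrictScalars ℤ) ≤
      endSaturatedConwayLattice N := by
  rw [Submodule.map_le_iff_le_comap]
  exact sSup_le fun M hM => Submodule.map_le_iff_le_comap.mp ((hM.2.1 p hp hpN).trans (le_sSup hM))

/-- A80.3b  Every integral lattice with the four stabilities lies in `S^{G,R}` (it IS the `sSup`). -/
theorem le_endSaturatedConwayLattice_of_stable {N : ℕ} [NeZero N] {M : Submodule ℤ (CuspForm (Gamma0 N) 2)}
    (hM : M ≤ integralCuspForms0 N 2)
    (hw : ∀ p : ℕ, p.Prime → p ∣ N → M.map ((atkinLehnerInvolutionAt N 2 p).restrictScalars ℤ) ≤ M)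
    (ht : M.map ((halfTranslate N 2).restrictScalars ℤ) ≤ M)
    (hR4 : 16 ∣ N → M.map ((ramanujanFour N 2).restrictScalars ℤ) ≤ M)
    (hR8 : 64 ∣ N → M.map ((ramanujanEight N 2).restrictScalars ℤ) ≤ M) :
    M ≤ endSaturatedConwayLattice N :=
  le_sSup ⟨hM, hw, ht, hR4, hR8⟩

/-- A80.4  E-imc-135's index is oriented as `[S^G : K(N)]`: Mathlib's `H.relIndex K` is the index of `H ⊓ K` in `K`
(definitional), and `K(N) ≤ S^G`. -/
theorem relIndex_orientation (N : ℕ) [NeZero N] :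
    (ramanujanFourPreimage N).toAddSubgroup.relIndex (conwayStableLattice N).toAddSubgroup =
      ((ramanujanFourPreimage N).toAddSubgroup.addSubgroupOf (conwayStableLattice N).toAddSubgroup).index :=
  rfl

/-- A80.5a  `cuspDim` is sound: `S₂(Γ₀(M))` is finite-dimensional in the tree (Sturm), so `Module.finrank` is the
dimension, not the junk `0`. -/
theorem cuspDim_finiteDimensional (M : ℕ) [NeZero M] : FiniteDimensional ℂ (CuspForm (Gamma0 M) 2) :=
  finiteDimensional_cuspForm_gamma0 M 2

/-- A80.5b  `s(N/d)` is read as `0` off the divisibility: definitional. -/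
theorem cuspDimDiv_of_not_dvd {N d : ℕ} (h : ¬ d ∣ N) : cuspDimDiv N d = 0 := if_neg h

/-- A80.5b (on the divisibility). -/
theorem cuspDimDiv_of_dvd {N d : ℕ} (h : d ∣ N) : cuspDimDiv N d = cuspDim (N / d) := if_pos h

/-- A80.5c  At `16 ∥ N` the tower count collapses to `♭(N) = s(N/16)`; e.g. `♭(240) = s(15) = 1`, `♭(272) = s(17) = 1`
(one halving each: matches desc PART B `[S^G : S^H] = 2` at `240` and E-imc-133's index `2` at `272`). -/
theorem towerCountFlat_of_not_thirtyTwo_dvd {N : ℕ} (h16 : 16 ∣ N) (h32 : ¬ 32 ∣ N) :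
    towerCountFlat N = cuspDim (N / 16) := by
  have h64 : ¬ 64 ∣ N := fun h => h32 (Nat.dvd_trans ⟨2, by norm_num⟩ h)
  have h128 : ¬ 128 ∣ N := fun h => h32 (Nat.dvd_trans ⟨4, by norm_num⟩ h)
  simp [towerCountFlat, cuspDimDiv_of_dvd h16, cuspDimDiv_of_not_dvd h32, cuspDimDiv_of_not_dvd h64,
    cuspDimDiv_of_not_dvd h128]

/-- A80.6  E-imc-134 ⟹ the `R₄`-defect quotient `S^G/K(N)` is killed by `2` (restates the sketch's own edge as an
inclusion of submodules). -/
theorem two_smul_conway_le_preimage (h : ConwayRamanujanExponentLaw) (N : ℕ) [NeZero N] (h16 : 16 ∣ N) :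
    (conwayStableLattice N).map (LinearMap.lsmul ℤ _ 2) ≤ ramanujanFourPreimage N := by
  rintro _ ⟨x, hx, rfl⟩
  simpa using two_smul_mem_ramanujanFourPreimage N h h16 hx

/-- A80.7  E-imc-129 (¬ `2`-adic `R₄`-stability at `240`) and E-imc-134 (`2R₄ S^G ⊆ S^G`) are jointly consistent
only if the defect is EXACTLY one halving; formally: E-imc-134 gives `LeUpToOdd`-stability of `S^G` under `2 • R₄`. -/
theorem leUpToOdd_two_ramanujanFour (h : ConwayRamanujanExponentLaw) (N : ℕ) [NeZero N] (h16 : 16 ∣ N) :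
    LeUpToOdd ((conwayStableLattice N).map (((2 : ℂ) • ramanujanFour N 2).restrictScalars ℤ))
      (conwayStableLattice N) := by
  rintro _ ⟨x, hx, rfl⟩
  refine ⟨1, odd_one, ?_⟩
  have := h N h16 x hx
  simpa [two_smul] using this

/-- A80.8  E-imc-132 ⟹ E-desc-28♯'s first clause and the `2`-adic lower containment, unconditionally (tree edge
`isConwayNeronAtTwo_of_isEndSaturated` needs `LeUpToOdd S^G S^{G,R}` for the rest — DENIED at `272` by E-imc-133). -/
theorem Λ_le_conway_of_isEndSaturated {N : ℕ} [NeZero N] {W : WeierstrassCurve ℚ} [W.IsElliptic]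
    {D : ModularParametrizationData W N} (Δ : NeronFLineDatum W D) (hΛ : IsEndSaturatedConwayNeronAtTwo Δ) :
    Δ.Λ ≤ conwayStableLattice N :=
  hΛ.1.trans (endSaturatedConwayLattice_le N)

end RefAudit80

end Summit.BirchSwinnertonDyer.Rank1Residual.ManinAdditive.NeronConwayD
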